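import Mathlib.Analysis.Complex.RemovableSingularity
import HarnessLib

/-!
# Stub `stub_riemann` of line `registered` (birth skeleton v2) — crux `UniformAnalyticExtension` (stmt-CriticalPhenomena-6047)

Riemann's removable-singularity theorem packaged for a whole open set `U ⊆ ℂ`: if `f : ℂ → ℂ` is
complex differentiable on a punctured neighbourhood of every point of `U` and bounded on a
punctured neighbourhood of every point of `U`, then the regularisation
`g z := limUnder (𝓝[≠] z) f` is complex differentiable on `U` and `f → g z` along `𝓝[≠] z` for
every `z ∈ U`.  In the skeleton this regularises the FK crossing ratio `N_δ/Z_δ` (a junk-valued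
quotient of polynomial evaluations) on the complex neighbourhood `U_ρ` of a real segment.

Proof.  The limit at each point is Mathlib's
`Complex.tendsto_limUnder_of_differentiable_on_punctured_nhds_of_bounded_under`.  For
differentiability at `c ∈ U`: on the neighbourhood
`s = {w | w ≠ c → f differentiable at w ∧ ‖f w‖ ≤ C}` of `c` the patched function
`update f c (limUnder (𝓝[≠] c) f)` is differentiable
(`Complex.differentiableOn_update_limUnder_of_bddAbove`) and agrees with `g` on `s` (off `c`,
`f` is continuous, so `limUnder (𝓝[≠] w) f = f w`).  Openness of `U` is not even needed.
All [folklore].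
-/

noncomputable section

open Filter Topology Set Metric

namespace Summit.CriticalPhenomena.CardyFormulaZ2.Cruxes.UniformAnalyticExtension.Birth

/-- **stub_riemann** (engine; Riemann's removable-singularity theorem packaged for an open set):
if `f : ℂ → ℂ` is complex differentiable on a punctured neighbourhood of every point of the open
set `U` and bounded on a punctured neighbourhood of every point of `U`, then there is `g`
differentiable on `U` with `f → g z` along `𝓝[≠] z` for every `z ∈ U` (so `g = f` wherever `f` is
continuous); `g z := limUnder (𝓝[≠] z) f` works. [folklore] -/
theorem stub_riemann :
    ∀ (U : Set ℂ) (f : ℂ → ℂ), IsOpen U →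
      (∀ z ∈ U, ∀ᶠ w in 𝓝[≠] z, DifferentiableAt ℂ f w) →
      (∀ z ∈ U, ∃ C : ℝ, ∀ᶠ w in 𝓝[≠] z, ‖f w‖ ≤ C) →
      ∃ g : ℂ → ℂ, DifferentiableOn ℂ g U ∧ ∀ z ∈ U, Tendsto f (𝓝[≠] z) (𝓝 (g z)) := by
  intro U f _ hd hb
  refine ⟨fun z => limUnder (𝓝[≠] z) f, fun c hc => ?_, fun z hz => ?_⟩
  · -- differentiability of the regularisation at `c ∈ U`
    obtain ⟨C, hC⟩ := hb c hc
    obtain ⟨s, hs, hmem⟩ : ∃ s ∈ 𝓝 c, ∀ w ∈ s, w ≠ c → DifferentiableAt ℂ f w ∧ ‖f w‖ ≤ C :=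
      ⟨{w | w ≠ c → DifferentiableAt ℂ f w ∧ ‖f w‖ ≤ C},
        eventually_nhdsWithin_iff.1 ((hd c hc).and hC), fun _ hw => hw⟩
    have hds : DifferentiableOn ℂ f (s \ {c}) :=
      fun w hw => (hmem w hw.1 hw.2).1.differentiableWithinAt
    have hbs : BddAbove (norm ∘ f '' (s \ {c})) := by
      refine ⟨C, ?_⟩
      rintro _ ⟨w, hw, rfl⟩
      exact (hmem w hw.1 hw.2).2
    have H : DifferentiableAt ℂ (Function.update f c (limUnder (𝓝[≠] c) f)) c :=
      (Complex.differentiableOn_update_limUnder_of_bddAbove hs hds hbs).differentiableAt hs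
    refine (H.congr_of_eventuallyEq ?_).differentiableWithinAt
    filter_upwards [hs] with w hw
    rcases eq_or_ne w c with h | hne
    · rw [h, Function.update_self]
    · rw [Function.update_of_ne hne]
      exact ((hmem w hw hne).1.continuousAt.tendsto.mono_left nhdsWithin_le_nhds).limUnder_eq
  · -- the limit at `z ∈ U`
    obtain ⟨C, hC⟩ := hb z hz
    exact Complex.tendsto_limUnder_of_differentiable_on_punctured_nhds_of_bounded_under (hd z hz)
      ⟨C + ‖f z‖, eventually_map.2 <| hC.mono fun w hw => norm_sub_le_of_le hw le_rfl⟩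

end Summit.CriticalPhenomena.CardyFormulaZ2.Cruxes.UniformAnalyticExtension.Birth
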